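import Mathlib

/-!
# Route `GenusKolyvaginAtTwo`, crux L_T `PowDvdShaCardAtTwoRT` (stmt-BirchSwinnertonDyer-23242), LINE 18 stub L, bottom rung:
# the NON-PHANTOM lemma (I) — cocycle generalities and arithmetic in a basis of `M ≅ (ℤ/4)²`

Seat `bsd-line-gk2-p3` g22 (PROVER 3/3, cell `bsd-f1-sign2`), `--supports stmt-BirchSwinnertonDyer-23242` (helper).
THEOREMS ONLY (Mathlib-only, no definition, no named fact, no `sorry`). BSD is not proved by any of this; neither is the crux.
File 1 of 3 (`…RTNonPhantomCocycleBasis` → `…RTNonPhantomTwoTorsionValues` → `…RTNonPhantomCoboundary`).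

WHY. The one-step ENGINE of the index-`≥ 2` bottom rung (LEAD gk2-p1 g16, `RelaxedCount.false_of_bottomRung_engine`,
memo `Cruxes/PowDvdShaCardAtTwoRT/Lines/plus-descent-lead-g16.md` §11–§12) feeds the full-order PAIR Čebotarev
(`PlusDescent.infinite_kolyvaginPrime_localization_fullOrder_pair`) whose separation hypothesis `hres` asks that no non-zero
class of the span `⟨c(n), res_K y⟩ ≤ H¹(K, E[4])` restricts to zero on `Γ_{K(E[4])}` — the NON-PHANTOM condition.  The
phantom subgroup `H¹(Gal(K(E[4])/K), E[4]) = H¹(GL₂(ℤ/4), (ℤ/4)²)` is `ℤ/2` (Lawson–Wuthrich 2016, §7.1), so `hres`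
is a genuine condition.  The series proves the group-theoretic fact that kills it on curves with an odd prime of
multiplicative reduction: **restriction from `GL₂(ℤ/4)` to the cyclic group of the Tate transvection `u = (1 1; 0 1)`
is injective on `H¹(·, (ℤ/4)²)`** — Lawson–Wuthrich's "localisation kernel is `0` for `dim M₂ = 4`" (loc. cit. §8,
by Magma) at the one cyclic subgroup that the inertia group of a multiplicative prime with `ord_p Δ` odd supplies.
Everything is phrased for an abstract group `Γ` acting on an abstract additive group `M` through a `1`-cocycle
`φ : Γ → M` (`φ (g h) = φ g + g • φ h`) that VANISHES ON THE KERNEL OF THE ACTION (a phantom class).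

THIS FILE: §1 cocycle generalities (value at `1`, at inverses, conjugation formula, shift by a coboundary, and the
key remark `cocycle_eq_of_forall_smul_eq`: a cocycle vanishing on the kernel of the action takes equal values on
elements acting identically); §2 arithmetic in a pair `P₁, P₂` spanning `M` freely modulo `4` (congruent coefficients,
membership in `2M`, elements `≡ 1 (mod 2)` fix `M[2]`, `M^{u,ℓ} = 0` for the two transvections).

References: T. Lawson, C. Wuthrich, *Vanishing of some Galois cohomology groups for elliptic curves*, in: Elliptic Curves,
Modular Forms and Iwasawa Theory, Springer Proc. Math. Stat. 188 (2016), §7.1 and §8 [arXiv:1505.02940];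
B. H. Gross, *Kolyvagin's work on modular elliptic curves* (1991), Prop. 9.1 (the odd-`p` injectivity whose `p = 2`
substitute this is); J.-P. Serre, *Abelian ℓ-adic representations* (1968), IV A.1.2 (Tate transvection).
-/

-- `Summit.<P>.<Sub>` repeats `BirchSwinnertonDyer` by the tree's layout convention (D-0017)
set_option linter.dupNamespace false
set_option autoImplicit false

namespace Summit.BirchSwinnertonDyer.BirchSwinnertonDyer.Theorems.GenusExact.NonPhantom

variable {Γ : Type*} [Group Γ] {M : Type*} [AddCommGroup M] [DistribMulAction Γ M]

/-! ## §1 Cocycle generalities -/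

/-- `g • (a • m) = a • (g • m)` for the `ℤ`-multiples. [folklore] -/
theorem smul_zsmul_comm (g : Γ) (a : ℤ) (m : M) : g • (a • m) = a • (g • m) :=
  map_zsmul (DistribSMul.toAddMonoidHom M g) a m

/-- A `1`-cocycle vanishes at `1`. [folklore] -/
theorem cocycle_one {φ : Γ → M} (hφ : ∀ g h, φ (g * h) = φ g + g • φ h) : φ 1 = 0 := by
  have h := hφ 1 1
  rw [mul_one, one_smul] at h
  -- `φ 1 = φ 1 + φ 1`
  have : φ 1 + φ 1 = φ 1 + 0 := by rw [add_zero]; exact h.symm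
  exact add_left_cancel this

/-- `φ g⁻¹ = -(g⁻¹ • φ g)` for a `1`-cocycle. [folklore] -/
theorem cocycle_inv {φ : Γ → M} (hφ : ∀ g h, φ (g * h) = φ g + g • φ h) (g : Γ) :
    φ g⁻¹ = -(g⁻¹ • φ g) := by
  have h := hφ g⁻¹ g
  rw [inv_mul_cancel, cocycle_one hφ] at h
  exact (neg_eq_of_add_eq_zero_left h.symm).symm

/-- **A cocycle vanishing on the kernel of the action depends only on the action**: if `g` and `h` act identically on
`M` then `φ g = φ h`. [folklore] -/
theorem cocycle_eq_of_forall_smul_eq {φ : Γ → M} (hφ : ∀ g h, φ (g * h) = φ g + g • φ h)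
    (hker : ∀ ρ : Γ, (∀ m : M, ρ • m = m) → φ ρ = 0) {g h : Γ} (hgh : ∀ m : M, g • m = h • m) :
    φ g = φ h := by
  have htriv : ∀ m : M, (h⁻¹ * g) • m = m := fun m ↦ by rw [mul_smul, hgh, inv_smul_smul]
  have := hφ h (h⁻¹ * g)
  rw [mul_inv_cancel_left, hker _ htriv, smul_zero, add_zero] at this
  exact this

/-- The conjugation formula `φ (g v g⁻¹) = φ g + g • φ v - (g v g⁻¹) • φ g`. [folklore] -/
theorem cocycle_conj {φ : Γ → M} (hφ : ∀ g h, φ (g * h) = φ g + g • φ h) (g v : Γ) :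
    φ (g * v * g⁻¹) = φ g + g • φ v - (g * v * g⁻¹) • φ g := by
  rw [hφ (g * v) g⁻¹, hφ g v, cocycle_inv hφ g, smul_neg, ← mul_smul, mul_assoc]
  abel

/-- Right multiplication by an element killed by the cocycle. [folklore] -/
theorem cocycle_mul_of_eq_zero_right {φ : Γ → M} (hφ : ∀ g h, φ (g * h) = φ g + g • φ h) {g v : Γ}
    (hv : φ v = 0) : φ (g * v) = φ g := by
  rw [hφ, hv, smul_zero, add_zero]

/-- Left multiplication by an element killed by the cocycle. [folklore] -/
theorem cocycle_mul_of_eq_zero_left {φ : Γ → M} (hφ : ∀ g h, φ (g * h) = φ g + g • φ h) {g v : Γ}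
    (hg : φ g = 0) : φ (g * v) = g • φ v := by
  rw [hφ, hg, zero_add]

/-- Shifting a cocycle by a coboundary keeps it a cocycle. [folklore] -/
theorem cocycle_sub_coboundary {φ : Γ → M} (hφ : ∀ g h, φ (g * h) = φ g + g • φ h) (c : M) :
    ∀ g h, (φ (g * h) - ((g * h) • c - c)) = (φ g - (g • c - c)) + g • (φ h - (h • c - c)) := by
  intro g h
  rw [hφ, mul_smul, smul_sub, smul_sub]
  abel

/-- A coboundary vanishes on elements acting trivially, so the shifted cocycle still vanishes on the kernel. [folklore] -/
theorem ker_sub_coboundary {φ : Γ → M} (hker : ∀ ρ : Γ, (∀ m : M, ρ • m = m) → φ ρ = 0) (c : M) :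
    ∀ ρ : Γ, (∀ m : M, ρ • m = m) → φ ρ - (ρ • c - c) = 0 := by
  intro ρ hρ
  rw [hker ρ hρ, hρ c, sub_self, sub_zero]

/-! ## §2 Arithmetic in a basis `P₁, P₂` of `M ≅ (ℤ/4)²` -/

section Basis

variable {P₁ P₂ : M}

/-- `g • (a • P₁ + b • P₂) = a • g • P₁ + b • g • P₂`. [folklore] -/
theorem smul_lincomb (g : Γ) (a b : ℤ) (P₁ P₂ : M) :
    g • (a • P₁ + b • P₂) = a • (g • P₁) + b • (g • P₂) := by
  rw [smul_add, smul_zsmul_comm, smul_zsmul_comm]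

/-- Two group elements agreeing on a spanning pair agree everywhere. [folklore] -/
theorem forall_smul_eq_of_basis (hspan : ∀ m : M, ∃ a b : ℤ, m = a • P₁ + b • P₂) {g h : Γ}
    (h₁ : g • P₁ = h • P₁) (h₂ : g • P₂ = h • P₂) : ∀ m : M, g • m = h • m := by
  intro m
  obtain ⟨a, b, rfl⟩ := hspan m
  rw [smul_lincomb, smul_lincomb, h₁, h₂]

/-- An element fixing a spanning pair acts trivially. [folklore] -/
theorem forall_smul_eq_self_of_basis (hspan : ∀ m : M, ∃ a b : ℤ, m = a • P₁ + b • P₂) {g : Γ}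
    (h₁ : g • P₁ = P₁) (h₂ : g • P₂ = P₂) : ∀ m : M, g • m = m := by
  intro m
  have := forall_smul_eq_of_basis hspan (g := g) (h := (1 : Γ)) (by rw [one_smul, h₁]) (by rw [one_smul, h₂]) m
  rwa [one_smul] at this

/-- `a • P = 0` when `4 ∣ a` and `4 • P = 0`. [folklore] -/
theorem zsmul_eq_zero_of_four_dvd {P : M} (h4 : (4 : ℤ) • P = 0) {a : ℤ} (ha : (4 : ℤ) ∣ a) : a • P = 0 := by
  obtain ⟨k, rfl⟩ := ha
  rw [mul_comm, mul_smul, h4, smul_zero]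

/-- Linear combinations with coefficients congruent mod `4` agree. [folklore] -/
theorem lincomb_congr (h4P₁ : (4 : ℤ) • P₁ = 0) (h4P₂ : (4 : ℤ) • P₂ = 0) {a b a' b' : ℤ}
    (ha : (4 : ℤ) ∣ a - a') (hb : (4 : ℤ) ∣ b - b') : a • P₁ + b • P₂ = a' • P₁ + b' • P₂ := by
  rw [← sub_eq_zero]
  have : a • P₁ + b • P₂ - (a' • P₁ + b' • P₂) = (a - a') • P₁ + (b - b') • P₂ := by
    rw [sub_smul, sub_smul]; abel
  rw [this, zsmul_eq_zero_of_four_dvd h4P₁ ha, zsmul_eq_zero_of_four_dvd h4P₂ hb, add_zero]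

/-- In `2M` the coefficients on the basis are even. [folklore] -/
theorem even_of_lincomb_eq_two_smul (hspan : ∀ m : M, ∃ a b : ℤ, m = a • P₁ + b • P₂)
    (hindep : ∀ a b : ℤ, a • P₁ + b • P₂ = 0 → (4 : ℤ) ∣ a ∧ (4 : ℤ) ∣ b) {a b : ℤ} {y : M}
    (h : a • P₁ + b • P₂ = (2 : ℤ) • y) : (2 : ℤ) ∣ a ∧ (2 : ℤ) ∣ b := by
  obtain ⟨α, β, rfl⟩ := hspan y
  have h0 : (a - 2 * α) • P₁ + (b - 2 * β) • P₂ = 0 := by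
    rw [sub_smul, sub_smul, mul_smul, mul_smul, ← sub_eq_zero.mpr h, smul_add]
    abel
  obtain ⟨h₁, h₂⟩ := hindep _ _ h0
  constructor <;> omega

/-- `P₁ ∉ 2M`. [folklore] -/
theorem basis_fst_ne_two_smul (hspan : ∀ m : M, ∃ a b : ℤ, m = a • P₁ + b • P₂)
    (hindep : ∀ a b : ℤ, a • P₁ + b • P₂ = 0 → (4 : ℤ) ∣ a ∧ (4 : ℤ) ∣ b) (y : M) : P₁ ≠ (2 : ℤ) • y := by
  intro h
  have h' : (1 : ℤ) • P₁ + (0 : ℤ) • P₂ = (2 : ℤ) • y := by rw [one_smul, zero_smul, add_zero]; exact h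
  have := (even_of_lincomb_eq_two_smul hspan hindep h').1
  omega

/-- `P₂ ∉ 2M`. [folklore] -/
theorem basis_snd_ne_two_smul (hspan : ∀ m : M, ∃ a b : ℤ, m = a • P₁ + b • P₂)
    (hindep : ∀ a b : ℤ, a • P₁ + b • P₂ = 0 → (4 : ℤ) ∣ a ∧ (4 : ℤ) ∣ b) (y : M) : P₂ ≠ (2 : ℤ) • y := by
  intro h
  have h' : (0 : ℤ) • P₁ + (1 : ℤ) • P₂ = (2 : ℤ) • y := by rw [one_smul, zero_smul, zero_add]; exact h
  have := (even_of_lincomb_eq_two_smul hspan hindep h').2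
  omega

/-- `P₁ - P₂ ∉ 2M`. [folklore] -/
theorem basis_sub_ne_two_smul (hspan : ∀ m : M, ∃ a b : ℤ, m = a • P₁ + b • P₂)
    (hindep : ∀ a b : ℤ, a • P₁ + b • P₂ = 0 → (4 : ℤ) ∣ a ∧ (4 : ℤ) ∣ b) (y : M) :
    P₁ - P₂ ≠ (2 : ℤ) • y := by
  intro h
  have h' : (1 : ℤ) • P₁ + (-1 : ℤ) • P₂ = (2 : ℤ) • y := by rw [one_smul, neg_one_zsmul, ← sub_eq_add_neg]; exact h
  have := (even_of_lincomb_eq_two_smul hspan hindep h').1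
  omega

/-- `Γ` preserves `2M`: if `g • x ∈ 2M` then `x ∈ 2M`. [folklore] -/
theorem exists_eq_two_smul_of_smul_eq (g : Γ) {x y : M} (h : g • x = (2 : ℤ) • y) :
    ∃ y' : M, x = (2 : ℤ) • y' :=
  ⟨g⁻¹ • y, by rw [← smul_zsmul_comm, ← h, inv_smul_smul]⟩

/-- An element `v ≡ 1 (mod 2)` (i.e. `v • P_i ∈ P_i + 2M`) fixes every `2`-torsion element (`4M = 0`). [folklore] -/
theorem smul_eq_self_of_congr_one (hM4 : ∀ m : M, (4 : ℤ) • m = 0)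
    (hspan : ∀ m : M, ∃ a b : ℤ, m = a • P₁ + b • P₂)
    (hindep : ∀ a b : ℤ, a • P₁ + b • P₂ = 0 → (4 : ℤ) ∣ a ∧ (4 : ℤ) ∣ b)
    {v : Γ} {y₁ y₂ : M} (hv₁ : v • P₁ = P₁ + (2 : ℤ) • y₁) (hv₂ : v • P₂ = P₂ + (2 : ℤ) • y₂)
    {x : M} (hx : (2 : ℤ) • x = 0) : v • x = x := by
  obtain ⟨a, b, rfl⟩ := hspan x
  have h2 : (2 * a) • P₁ + (2 * b) • P₂ = 0 := by
    rw [mul_smul, mul_smul, ← smul_add]; exact hx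
  obtain ⟨ha4, hb4⟩ := hindep _ _ h2
  obtain ⟨a', ha'⟩ : ∃ a', a = 2 * a' := ⟨a / 2, by omega⟩
  obtain ⟨b', hb'⟩ : ∃ b', b = 2 * b' := ⟨b / 2, by omega⟩
  rw [smul_lincomb, hv₁, hv₂, smul_add, smul_add]
  have e₁ : a • ((2 : ℤ) • y₁) = 0 := by
    rw [ha', smul_smul, show 2 * a' * 2 = a' * 4 by ring, mul_smul, hM4, smul_zero]
  have e₂ : b • ((2 : ℤ) • y₂) = 0 := by
    rw [hb', smul_smul, show 2 * b' * 2 = b' * 4 by ring, mul_smul, hM4, smul_zero]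
  rw [e₁, e₂, add_zero, add_zero]

/-- `M^{u, ℓ} = 0` for the two transvections `u : P₂ ↦ P₁ + P₂`, `ℓ : P₁ ↦ P₁ + P₂`. [folklore] -/
theorem eq_zero_of_fixed_transvections (hspan : ∀ m : M, ∃ a b : ℤ, m = a • P₁ + b • P₂)
    (hindep : ∀ a b : ℤ, a • P₁ + b • P₂ = 0 → (4 : ℤ) ∣ a ∧ (4 : ℤ) ∣ b)
    (h4P₁ : (4 : ℤ) • P₁ = 0) (h4P₂ : (4 : ℤ) • P₂ = 0)
    {u ℓ : Γ} (huP₁ : u • P₁ = P₁) (huP₂ : u • P₂ = P₁ + P₂) (hℓP₁ : ℓ • P₁ = P₁ + P₂) (hℓP₂ : ℓ • P₂ = P₂)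
    {x : M} (hux : u • x = x) (hℓx : ℓ • x = x) : x = 0 := by
  obtain ⟨a, b, rfl⟩ := hspan x
  rw [smul_lincomb, huP₁, huP₂] at hux
  rw [smul_lincomb, hℓP₁, hℓP₂] at hℓx
  have hb0 : b • P₁ + (0 : ℤ) • P₂ = 0 := by
    rw [zero_smul, add_zero]
    have := sub_eq_zero.mpr hux
    rw [smul_add] at this
    -- `a P₁ + (b P₁ + b P₂) - (a P₁ + b P₂) = b P₁`
    have e : a • P₁ + (b • P₁ + b • P₂) - (a • P₁ + b • P₂) = b • P₁ := by abel
    rwa [e] at this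
  have ha0 : (0 : ℤ) • P₁ + a • P₂ = 0 := by
    rw [zero_smul, zero_add]
    have := sub_eq_zero.mpr hℓx
    rw [smul_add] at this
    have e : a • P₁ + a • P₂ + b • P₂ - (a • P₁ + b • P₂) = a • P₂ := by abel
    rwa [e] at this
  have hb := (hindep _ _ hb0).1
  have ha := (hindep _ _ ha0).2
  rw [zsmul_eq_zero_of_four_dvd h4P₁ ha, zsmul_eq_zero_of_four_dvd h4P₂ hb, add_zero]

end Basis

end Summit.BirchSwinnertonDyer.BirchSwinnertonDyer.Theorems.GenusExact.NonPhantom
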